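import Summits.ResolutionOfSingularities.ResolutionOfSingularities.Theorems.OddCrossCutCells
import Summits.ResolutionOfSingularities.ResolutionOfSingularities.Theorems.AbsoluteContactHasse
import Summits.ResolutionOfSingularities.ResolutionOfSingularities.Theorems.AbsoluteContactPrimitives
import Summits.ResolutionOfSingularities.ResolutionOfSingularities.Theorems.AbsoluteContactInsep
import Literature.AlgebraicGeometry.Resolution.OrderSemicontinuityPointwise
import Literature.AlgebraicGeometry.Resolution.HasseMaximalContactOrigin
import HarnessLib

/-!
# ResidueCutLaws — decomp-res node «ResidueCut» (lens-2 g25, critic row 200 CLEARED MAP +1), tree file 1/4 of the node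

Content VERBATIM from the decomp-res lens-2 g25 node `HOME/decomp-res-lens-2/g25/ResidueCut.lean` (pin 4d29427b, 750
l; HOME = run/shared/lean/pub/decomp-res): NO carry — the node imports the LANDED tree only
(`…Theorems.MaxContactCutOddCrossCut`, `AbsoluteContactHasse`, `AbsoluteContactPrimitives`, `AbsoluteContactInsep`,
Literature `OrderSemicontinuityPointwise` / `HasseMaximalContactOrigin`); every declaration is new; namespace
`…Theses.ResidueCut` ↦ `…Theorems.ResidueCut` (critic's ns suggestion; same renaming as OddCrossCut / CuspCut);
independent of the g24 «CuspCut» files.  Farm (node; lens + critic runs): rc 0 · 0 warn · 0 sorry · axioms std on 11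
key decls; Probe 10/10 (P7 the existence must-fail).  Critic: CRITIC-LEDGER row 200 «ResidueCut» CLEARED MAP +1 ONCE
((M-Residue) of row 197a consumed): THE RESIDUE-FIELD DICHOTOMY of column 29273 — the law
`isContactPt_of_sepResidue` (separable-residue Hasse lemma at every marking prime to `p`) carried to ALL top points
by the two new kernels `isContactPt_of_specializes` (L2) and `exists_isClosed_specializes` (L3); CUT A on the data
(perfect-coprime slice `RungOnePerfCoprime` DECIDED in kernel from `E 2`, wild-or-imperfect slice `RungOneWild` =
the residual, `rungOne_iff_wild`); CUT B inside the located class of EVERY leaf (`Res` schema: `Leaf.SpecialRung L ⟺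
ResSpecialRung L`, the separable kind EMPTY); the cn30 residual-membership law; §7 ring-level certificates (order-≤1
operators blind to `p`-th powers, the insepF certificate, corner39 a CONTACT point — erratum of rows 180/184).
Landing orders = critic rider INBOX 2026-08-31T08:52:28Z (R1/R2/R3) with the lens note 08:49:37Z («keep
`ResX.closes` in the Theses-cone file», ACK 09:07:12Z): (R1) `ResidueCutLaws*` = §1–§2 (imports the node's cone-free
imports, `OddCrossCutCells` for `MaxContactCutOddCrossCut`), (R2) `ResidueCutCells*` = §3–§6b minus the wiring (CUT
A slices, `namespace Res` schema, §5 readings, §6b aliases + cn30 laws — the cone-free ASIDE-CANDIDATE home of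
`RungOneWild` / `Res.ResWildSpecialRung`), (R3) `ResidueCutCertificates` = §7 (`section RingLevel` / `Inhabitant` /
`Corner39`), (M) `MaxContactCutResidueCut` = the wiring BY NAME on the host route (`rungOne_iff_wild`, `closesA`,
`namespace ResX`: `rungOne_iff`, `closes`, `closes_of_engines`, …); all VERBATIM, `--kind proof --supports
stmt-ResolutionOfSingularities-29273`; NO aside switch (lens-2's filed aside stays `LeafSpecialRung` 33866; 0-weight
docstring patch).  The `def … : Prop` declarations (`IsSepKindPt`, `SeqDimFourPerfCoprime`, `SeqDimFourWild`,
`RungOnePerfCoprime`, `RungOneWild`, `Res.IsResSpecialPt`, `Res.SeqResSpec`, `Res.SeqResWildSpec`,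
`Res.ResSpecialRung`, `Res.ResWildSpecialRung`, `ResX.OddResSpecialRung`) are THIS node's kinds / slices / cells
(cn26) — none is a vendored fact; `insepT` / `insepF` / `insepLine` / `corner39` are noncomputable `MvPolynomial`
data of the certificates.

The lens header, verbatim:

> # ResidueCut — decomp-res lens-2 («structural dichotomy») g25: THE RESIDUE-FIELD DICHOTOMY of column 29273
>
> COLUMN TARGET (BY NAME): `MaxContactCut.RungOne : E 2 → E 1` (tree item stmt-ResolutionOfSingularities-29273); located
> residual before this node: `OddX.OddSpecialRung` (tree, g23) refined by g24's `CuspX.CuspSpecialRung` (HOME, critic row 197).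
>
> ## THE LAW (kernel, hypothesis-free, every marking)
>
> At a marking `n` PRIME TO the characteristic `p`, every CLOSED top point (`ord_y I = n`) with SEPARABLE residue field
> `κ(y)/k` has `k`-linear maximal CONTACT (`isContactPt_of_sepResidue`: the tree's PROVED separable-residue Hasse lemma
> `AbsoluteContactClasses.hsPortSepResidue` at `N = n − 1`; the lineage had used it at marking 3 only).  Two NEW kernels
> carry it to ALL top points: (L2) `k`-contact GENERISES along equal order (`isContactPt_of_specializes`, from
> `stalkIdeal_le_pow_of_specializes`); (L3) in the `SeqDimFour` frame every top point has a CLOSED top specialisation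
> (`exists_isClosed_specializes`, compactness + `idealOrder_le_of_specializes`).  Hence (`classGE_of_perfectField`): over a
> PERFECT field at `p ∤ n` EVERY top point is of class ≥ j for every j — the hypothesis of `SeqDimFour 2 n` is automatic.
>
> ## CUT A — the lens's dichotomy ON THE DATA (fields × markings), exact by `em`
>
>   generic  = (k perfect ∧ p ∤ n):  `RungOnePerfCoprime`  — DECIDED IN KERNEL from `E 2` (`rungOnePerfCoprime_holds`,
>              indeed the slice of `SeqDimFour j n` is the same statement for all `j`, `seqDimFourPerfCoprime_iff`: on this
>              slice column 29273 coincides with lens-5's contact column `j = 5`);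
>   special  = (p ∣ n ∨ k imperfect):  `RungOneWild` — THE RESIDUAL (WEAKER by letter, UNDECIDED);
>   `rungOne_iff_wild : MaxContactCut.RungOne ⟺ RungOneWild`,  `closesA : RungOneWild → MaxContactCut.RungOne`.
>
> ## CUT B — the same law INSIDE the located class, for EVERY leaf `L` of the lineage at once
>
>   `Leaf.SpecialRung L ⟺ ResSpecialRung L` EXACT & HYP-FREE (`specialRung_iff_resSpecialRung`): the res-special class
>   `IsResSpecialPt L` drops every `L`-special point having a separable closed specialisation of the same order at `p ∤ n`
>   — that kind is EMPTY (`not_isSpecPt_of_isSepKindPt`).  BY NAME on the tree: `OddX.OddSpecialRung ⟺ ResSpecialRung oddLeaf`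
>   (`oddSpecialRung_iff_res`), and combined with CUT A: `closes : OddX.OddGenericRung → ResWildSpecialRung oddLeaf →
>   MaxContactCut.RungOne` (the residual after g25 = odd-special points WITHOUT separable closed equal-order specialisation,
>   on data with `p ∣ n ∨ k imperfect`).  g24's `CuspX.CuspSpecialRung` (HOME, not yet landed) is the instance `L := cuspLeaf`
>   of the same two schema theorems, verbatim.
>
> ## WHICH SIDE CARRIES THE DIFFICULTY (honest)
> `p ∣ n` (at the lineage's marking 2: exactly `p = 2` — the cusp kinds of g24, engine `CuspExit` HYP) and IMPERFECT ground
> fields (top points all of whose equal-order closed specialisations have inseparable residue field, e.g. the totally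
> inseparable line `T = u = v = 0`, `T = t^p − a` over `𝔽_p(a)`, for `I = (T² + u³ + v³)`, `p ≥ 5`: contact-free, τ = 1).
> FALLOUT: g24's tame class `IsUniformTameCurve` (residue characteristic ≠ 2 ⇒ `p` odd ⇒ `p ∤ 2`) meets the residual
> ONLY over imperfect fields (= ρ3, port family L); over perfect fields the tame special class is EMPTY and the engine
> `TameTwoExit` is never invoked by the column (`not_isLeafSpecialPt_of_perfectField`).
>
> ## RESIDUAL-MEMBERSHIP LAW (cn30) and RING-LEVEL CERTIFICATES (§6b, §7)
> `dvd_or_not_sepResidueAt_of_not_classGE_two`: at a CLOSED top point NOT of class ≥ 2, `p ∣ n ∨ ¬ SepResidueAt g y` — an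
> inhabitant certifies a cell of this column only with this clause.  §7 (ring level, kernel): ORDER-`≤ 1` OPERATORS ARE
> BLIND TO `p`-TH POWERS (`apply_mul_pow_of_isDiffOpLE_one_of_cast_eq_zero`: `D (g·x^p) = x^p·D g`), whence the
> inseparable-kind inhabitant `f = (t^p − a)² + u³ + v³` has `Diff^{≤1}((f)) + (f) ⊆ (t^p − a, u, v)²`
> (`diffIdeal_one_sup_le`: NO `k`-contact along its top line, every `p`; residual membership argued in the docstring), and
> the CONTROL: corner39's origin carries a first Hasse derivative in `Diff^{≤1} ∩ 𝔪 ∖ 𝔪²` (`corner39_origin_contact`, from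
> the tree's `exists_hasseDeriv_order_one_of_not_dvd`, `3 ∤ 2`) — a CONTACT point, not special (erratum of rows 180(α)/184).
>
> TAGS: `RungOnePerfCoprime` DECIDED (kernel) · `RungOneWild` WEAKER · UNDECIDED (the residual; leaves: `p ∣ n` wild
> kinds IDEA-NEEDED, imperfect kind ATTACKABLE via lens-6's absolute contact `isAbsContactAt_of_not_dvd` = READING) ·
> `ResSpecialRung L` ≡ `SpecialRung L` EXACT (separable kind EMPTY · DECIDED) · all re-locations hyp-free · 0 sorry.
> (Sources: EGAIV4 Thm. 16.11.2; StacksProject 00TV; CossartPiltant2008 Prop. 4.2; VillamayorU2008ReesDiff §4.1;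
> BierstoneGrigorievMilmanWlodarczyk2011 §3.1; Cutkosky2009; Hironaka1964 Ch. III; Kollar2007 Lemma 3.74; Hauser2003 §4.)

## This file

§1 THE LAWS (kernel, hypothesis-free): `isContactPt_of_sepResidue` (at a marking prime to `p`, a CLOSED top point
with SEPARABLE residue field has `k`-linear maximal contact — the tree's `AbsoluteContactClasses.hsPortSepResidue`
at `N = n − 1`), (L2) `isContactPt_of_specializes` (contact generises along equal order, from
`stalkIdeal_le_pow_of_specializes`), (L3) `exists_isClosed_specializes` / `exists_isClosed_top_specializes` (every
top point of the `SeqDimFour` frame has a CLOSED top specialisation), `classGE_of_perfectField`; §2 THE SEPARABLE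
KIND at a point `IsSepKindPt` and its emptiness in the located class (`not_isSpecPt_of_isSepKindPt`,
`not_sepResidueAt_of_isLeafSpecialPt`, …).

[WRITER NOTE (decomp-res writer g13): file split only (tree files ≤ 400 lines); sections, namespaces, section
`open`s and every declaration exactly as in the lens (the node's HOME-only dupNamespace-linter line is dropped; the
namespace-level `open` lines of the node are replayed in every part, the `open …Theses` line only in the Theses-cone
file `MaxContactCutResidueCut`); namespace renamed `…Theses.ResidueCut` ↦ `…Theorems.ResidueCut`.]

(Sources: EGAIV4 Thm. 16.11.2; StacksProject 00TV; CossartPiltant2008 Prop. 4.2; VillamayorU2008ReesDiff §4.1;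
BierstoneGrigorievMilmanWlodarczyk2011 §3.1; Cutkosky2009; Hironaka1964 Ch. III; Kollar2007 Lemma 3.74; Hauser2003 §4.)
-/

open CategoryTheory AlgebraicGeometry TopologicalSpace IsLocalRing
open Literature.AlgebraicGeometry.Resolution
open Summit.ResolutionOfSingularities.ResolutionOfSingularities.Theorems
open Summit.ResolutionOfSingularities.ResolutionOfSingularities.Theorems.WeakOrderReduction
open Summit.ResolutionOfSingularities.ResolutionOfSingularities.Theorems.ForcedTowerClasses
open Summit.ResolutionOfSingularities.ResolutionOfSingularities.Theorems.CurveLeafExit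
open Summit.ResolutionOfSingularities.ResolutionOfSingularities.Theorems.PurityCut
open Summit.ResolutionOfSingularities.ResolutionOfSingularities.Theorems.AbsoluteContactClasses
open Summit.ResolutionOfSingularities.ResolutionOfSingularities.Theorems.DeltaFaceCutClasses
open Summit.ResolutionOfSingularities.ResolutionOfSingularities.Theorems.RelativeDeltaCut
open Summit.ResolutionOfSingularities.ResolutionOfSingularities.Theorems.DeepCrossCut
open Summit.ResolutionOfSingularities.ResolutionOfSingularities.Theorems.PinchCut
open Summit.ResolutionOfSingularities.ResolutionOfSingularities.Theorems.JetCut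
open Summit.ResolutionOfSingularities.ResolutionOfSingularities.Theorems.SplitCut
open Summit.ResolutionOfSingularities.ResolutionOfSingularities.Theorems.CylinderCut
open Summit.ResolutionOfSingularities.ResolutionOfSingularities.Theorems.SpreadCut
open Summit.ResolutionOfSingularities.ResolutionOfSingularities.Theorems.CrossCut
open Summit.ResolutionOfSingularities.ResolutionOfSingularities.Theorems.OddCrossCut

namespace Summit.ResolutionOfSingularities.ResolutionOfSingularities.Theorems.ResidueCut

/-! ## §1  The laws (kernel, hypothesis-free) -/

/-- **LAW 1 · separable closed top points prime to `p` have `k`-contact** — the tree's separable-residue Hasse lemma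
`hsPortSepResidue` at `N = n − 1` (`h ∈ 𝔪^n ∖ 𝔪^{n+1}`, `p ∤ n` ⇒ a `k`-linear operator of order `≤ n−1` takes `h` to
adic order `1`), pushed to a section of `Diff^{≤ n−1}(I)` exactly as the tree's marking-3
`isContactPt_of_idealOrder_eq_three_of_sep`.
KERNEL (PROVED). (Sources: EGAIV4 Thm. 16.11.2; StacksProject 00TV; VillamayorU2008ReesDiff §4.1.) -/
theorem isContactPt_of_sepResidue {p : ℕ} (hp : p.Prime) {n : ℕ} (hn : 1 ≤ n) (hpn : ¬ p ∣ n)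
    {k : Type} [Field k] [CharP k p] {Y : Scheme.{0}} (g : Y ⟶ Spec (.of k)) (hB : IsBase Y g)
    (I : Y.IdealSheafData) {y : Y} (hy : IsClosed ({y} : Set Y)) (hsep : SepResidueAt g y)
    (hord : idealOrder I y = ((n : ℕ) : ℕ∞)) : IsContactPt g I n y := by
  obtain ⟨N, rfl⟩ : ∃ N, n = N + 1 := ⟨n - 1, by omega⟩
  haveI : LocallyOfFiniteType g := hB.locallyOfFiniteType
  set φ : k →+* Γ(Y, ⊤) := g.appTop.hom.comp (Scheme.ΓSpecIso (.of k)).inv.hom with hφ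
  have hft : HasFiniteTypeSections φ := hasFiniteTypeSections_of_locallyOfFiniteType k g
  have hle : stalkIdeal I y ≤ maximalIdeal (Y.presheaf.stalk y) ^ (N + 1) :=
    (le_idealOrder_iff I y (N + 1)).mp hord.ge
  have hnle : ¬ stalkIdeal I y ≤ maximalIdeal (Y.presheaf.stalk y) ^ (N + 2) := by
    intro h
    have h1 := (le_idealOrder_iff I y (N + 2)).mpr h
    rw [hord] at h1
    exact absurd (ENat.coe_le_coe.mp h1) (by omega)
  obtain ⟨h, hhI, hh2⟩ : ∃ h ∈ stalkIdeal I y, h ∉ maximalIdeal (Y.presheaf.stalk y) ^ (N + 2) := by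
    by_contra hcon
    push Not at hcon
    exact hnle hcon
  have hh1 : h ∈ maximalIdeal (Y.presheaf.stalk y) ^ (N + 1) := hle hhI
  letI := stalkAlgebra φ y
  obtain ⟨D, hD, hz⟩ := hsPortSepResidue p hp k Y g hB y hy hsep N h hh1 hh2 hpn
  set J : Y.IdealSheafData := diffIdealSheaf φ N I with hJ
  have hzJ : D h ∈ stalkIdeal J y := by
    rw [hJ, stalkIdeal_diffIdealSheaf hft]
    exact apply_mem_diffIdeal k hD hhI
  have hz1 := (adicOrder_eq_one_iff (D h)).mp hz
  have hJ2 : ¬ stalkIdeal J y ≤ maximalIdeal (Y.presheaf.stalk y) ^ 2 := fun hle2 => hz1.2 (hle2 hzJ)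
  obtain ⟨U', hU', hyU', -⟩ := exists_isAffineOpen_mem_and_subset (X := Y) (x := y) (U := ⊤) (Opens.mem_top y)
  set U : Y.affineOpens := ⟨U', hU'⟩
  obtain ⟨u, huJ, hu2⟩ := exists_section_germ_not_mem_sq J hJ2 U hyU'
  have hyJ : y ∈ J.support := by
    rw [hJ]
    exact mem_support_diffIdealSheaf_of_le_idealOrder hft I (by rw [hord])
  have hum : (Y.presheaf.germ U y hyU').hom u ∈ maximalIdeal (Y.presheaf.stalk y) := by
    have h1 : (Y.presheaf.germ U y hyU').hom u ∈ stalkIdeal J y := by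
      rw [stalkIdeal_eq_map_germ J U hyU']
      exact Ideal.mem_map_of_mem _ huJ
    exact (mem_support_iff_stalkIdeal_le J y).mp hyJ h1
  refine ⟨U, hyU', u, ?_, hum, hu2⟩
  simpa [hJ] using huJ

/-- **LAW 2 (NEW) · `k`-contact generises along equal order**: if `ζ ⤳ x`, `x` is a contact point at marking `n ≥ 1`
and `ord_ζ I ≥ n`, then `ζ` is a contact point — the contact section's germ has order `1` at `x`, hence order `≤ 1` at
`ζ` (`stalkIdeal_le_pow_of_specializes`, orders never drop under generisation on a regular scheme), and it vanishes at
`ζ` because `Diff^{≤ n−1}(I)` does on `{ord ≥ n}`.  KERNEL (PROVED). (Sources: CossartPiltant2008 Prop. 4.2;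
Hironaka1964 Ch. III.) -/
theorem isContactPt_of_specializes {k : Type} [Field k] {Y : Scheme.{0}} (g : Y ⟶ Spec (.of k))
    [LocallyOfFiniteType g] (hY : Scheme.IsRegular Y) (I : Y.IdealSheafData) {n : ℕ} (hn : 1 ≤ n) {ζ x : Y}
    (hζx : ζ ⤳ x) (hx : IsContactPt g I n x) (hζ : ((n : ℕ) : ℕ∞) ≤ idealOrder I ζ) : IsContactPt g I n ζ := by
  set φ : k →+* Γ(Y, ⊤) := g.appTop.hom.comp (Scheme.ΓSpecIso (.of k)).inv.hom with hφ
  have hft : HasFiniteTypeSections φ := hasFiniteTypeSections_of_locallyOfFiniteType k g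
  obtain ⟨U, hxU, u, huJ, hum, hu2⟩ := hx
  set J : Y.IdealSheafData := diffIdealSheaf φ (n - 1) I with hJ
  haveI : IsRegularLocalRing (Y.presheaf.stalk x) := hY x
  have hJx : ¬ stalkIdeal J x ≤ maximalIdeal (Y.presheaf.stalk x) ^ 2 := by
    intro hle
    apply hu2
    apply hle
    rw [stalkIdeal_eq_map_germ J U hxU]
    exact Ideal.mem_map_of_mem _ huJ
  have hJζ : ¬ stalkIdeal J ζ ≤ maximalIdeal (Y.presheaf.stalk ζ) ^ 2 :=
    fun hle => hJx (stalkIdeal_le_pow_of_specializes hζx J hle)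
  obtain ⟨V', hV', hζV', -⟩ := exists_isAffineOpen_mem_and_subset (X := Y) (x := ζ) (U := ⊤) (Opens.mem_top ζ)
  set V : Y.affineOpens := ⟨V', hV'⟩
  obtain ⟨v, hvJ, hv2⟩ := exists_section_germ_not_mem_sq J hJζ V hζV'
  have hζJ : ζ ∈ J.support := by
    rw [hJ]
    apply mem_support_diffIdealSheaf_of_le_idealOrder hft I
    rw [Nat.sub_add_cancel hn]
    exact hζ
  have hvm : (Y.presheaf.germ V ζ hζV').hom v ∈ maximalIdeal (Y.presheaf.stalk ζ) := by
    have h1 : (Y.presheaf.germ V ζ hζV').hom v ∈ stalkIdeal J ζ := by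
      rw [stalkIdeal_eq_map_germ J V hζV']
      exact Ideal.mem_map_of_mem _ hvJ
    exact (mem_support_iff_stalkIdeal_le J ζ).mp hζJ h1
  exact ⟨V, hζV', v, hvJ, hvm, hv2⟩

/-- **LAW 3 (NEW) · closed specialisations exist** on the (quasi-compact) base of a `SeqDimFour` datum. KERNEL (PROVED;
Mathlib `IsClosed.exists_closed_singleton`). [folklore] -/
theorem exists_isClosed_specializes {k : Type} [Field k] {Y : Scheme.{0}} (g : Y ⟶ Spec (.of k)) [QuasiCompact g]
    (ζ : Y) : ∃ x : Y, IsClosed ({x} : Set Y) ∧ ζ ⤳ x := by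
  haveI : CompactSpace Y := QuasiCompact.compactSpace_of_compactSpace g
  obtain ⟨x, hx, hxc⟩ := (isClosed_closure (s := ({ζ} : Set Y))).exists_closed_singleton
    ((Set.singleton_nonempty ζ).closure)
  exact ⟨x, hxc, specializes_iff_mem_closure.mpr hx⟩

/-- **LAW 3′ · every top point has a CLOSED TOP specialisation** when the orders are bounded by the marking (the frame of
`SeqDimFour`): `ord` never drops under specialisation (`idealOrder_le_of_specializes`). KERNEL (PROVED).
(Sources: CossartPiltant2008 Prop. 4.2.) -/
theorem exists_isClosed_top_specializes {k : Type} [Field k] {Y : Scheme.{0}} (g : Y ⟶ Spec (.of k)) [QuasiCompact g]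
    (hY : Scheme.IsRegular Y) (I : Y.IdealSheafData) {n : ℕ} (hle : ∀ y : Y, idealOrder I y ≤ ((n : ℕ) : ℕ∞))
    {ζ : Y} (hζ : idealOrder I ζ = ((n : ℕ) : ℕ∞)) :
    ∃ x : Y, IsClosed ({x} : Set Y) ∧ ζ ⤳ x ∧ idealOrder I x = ((n : ℕ) : ℕ∞) := by
  obtain ⟨x, hxc, hζx⟩ := exists_isClosed_specializes g ζ
  haveI : IsRegularLocalRing (Y.presheaf.stalk x) := hY x
  exact ⟨x, hxc, hζx, le_antisymm (hle x) (hζ ▸ idealOrder_le_of_specializes hζx I)⟩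

/-! ## §2  The separable kind at a point and its emptiness in the located class -/

/-- **The SEPARABLE KIND at a point** (`k` read off `g`): the marking is prime to the characteristic and `y` has a
CLOSED specialisation of the same order with SEPARABLE residue field over `k` (`y` itself when `y` is closed).
DEFINITION (NEW class). (Sources: EGAIV4 Thm. 16.11.2; StacksProject 00TV.) -/
def IsSepKindPt {k : Type} [Field k] {Y : Scheme.{0}} (g : Y ⟶ Spec (.of k)) (I : Y.IdealSheafData) (n : ℕ)
    (y : Y) : Prop :=
  ¬ ringChar k ∣ n ∧ ∃ x : Y, y ⤳ x ∧ IsClosed ({x} : Set Y) ∧ SepResidueAt g x ∧ idealOrder I x = ((n : ℕ) : ℕ∞)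

/-- **kernel · the separable kind is of class ≥ j for every j** (it has `k`-contact: LAW 1 at the closed point, LAW 2
up to `y`). KERNEL (PROVED). (Sources: EGAIV4 Thm. 16.11.2; CossartPiltant2008 Prop. 4.2.) -/
theorem isContactPt_of_isSepKindPt {p : ℕ} (hp : p.Prime) {k : Type} [Field k] [CharP k p] {Y : Scheme.{0}}
    (g : Y ⟶ Spec (.of k)) (hB : IsBase Y g) (I : Y.IdealSheafData) {n : ℕ} (hn : 1 ≤ n) {y : Y}
    (hord : idealOrder I y = ((n : ℕ) : ℕ∞)) (h : IsSepKindPt g I n y) : IsContactPt g I n y := by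
  obtain ⟨hpn, x, hyx, hxc, hsep, hordx⟩ := h
  rw [ringChar.eq k p] at hpn
  haveI : LocallyOfFiniteType g := hB.locallyOfFiniteType
  exact isContactPt_of_specializes g hB.isRegular I hn hyx
    (isContactPt_of_sepResidue hp hn hpn g hB I hxc hsep hordx) hord.ge

/-- `classGE_of_isSepKindPt`: Auxiliary step of this node's calculus, VERBATIM from the lens file (see the module
docstring); the statement is its type. [folklore] -/
theorem classGE_of_isSepKindPt {p : ℕ} (hp : p.Prime) {k : Type} [Field k] [CharP k p] {Y : Scheme.{0}}
    (g : Y ⟶ Spec (.of k)) (hB : IsBase Y g) (I : Y.IdealSheafData) {n : ℕ} (hn : 1 ≤ n) (j : ℕ) {y : Y}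
    (hord : idealOrder I y = ((n : ℕ) : ℕ∞)) (h : IsSepKindPt g I n y) : ClassGE g hB.isRegular I n j y :=
  Or.inr (Or.inl (isContactPt_of_isSepKindPt hp g hB I hn hord h))

/-- **kernel · NO LEAF-SPECIAL POINT IS OF THE SEPARABLE KIND** (leaf-special ⇒ not class ≥ 2,
`not_gen_of_isLeafSpecialPt`). KERNEL (PROVED). [folklore] -/
theorem not_isLeafSpecialPt_of_isSepKindPt {p : ℕ} (hp : p.Prime) {k : Type} [Field k] [CharP k p]
    {Y : Scheme.{0}} (g : Y ⟶ Spec (.of k)) (hB : IsBase Y g) (I : Y.IdealSheafData) {n : ℕ} (hn : 1 ≤ n)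
    {y : Y} (hord : idealOrder I y = ((n : ℕ) : ℕ∞)) (h : IsSepKindPt g I n y) :
    ¬ IsLeafSpecialPt g hB.isRegular I n y :=
  fun hs => not_gen_of_isLeafSpecialPt hs (Or.inl (classGE_of_isSepKindPt hp g hB I hn 2 hord h))

/-- **kernel · for EVERY leaf `L`, no `L`-special point is of the separable kind.** KERNEL (PROVED). [folklore] -/
theorem not_isSpecPt_of_isSepKindPt (L : ∀ ⦃Y : Scheme.{0}⦄, Y.IdealSheafData → ℕ → Y → Prop) {p : ℕ}
    (hp : p.Prime) {k : Type} [Field k] [CharP k p] {Y : Scheme.{0}} (g : Y ⟶ Spec (.of k)) (hB : IsBase Y g)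
    (I : Y.IdealSheafData) {n : ℕ} (hn : 1 ≤ n) {y : Y} (hord : idealOrder I y = ((n : ℕ) : ℕ∞))
    (h : IsSepKindPt g I n y) : ¬ Leaf.IsSpecPt L g hB.isRegular I n y :=
  fun hs => not_isLeafSpecialPt_of_isSepKindPt hp g hB I hn hord h hs.1

/-- **kernel · over a PERFECT field at `p ∤ n` EVERY top point is of the separable kind** (LAW 3′ + the tree's
`sepResidueAt_of_perfectField`). KERNEL (PROVED). [folklore] -/
theorem isSepKindPt_of_perfectField {p : ℕ} {k : Type} [Field k] [CharP k p] [PerfectField k] {Y : Scheme.{0}}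
    (g : Y ⟶ Spec (.of k)) [QuasiCompact g] [LocallyOfFiniteType g] (hY : Scheme.IsRegular Y)
    (I : Y.IdealSheafData) {n : ℕ} (hpn : ¬ p ∣ n) (hle : ∀ y : Y, idealOrder I y ≤ ((n : ℕ) : ℕ∞)) {y : Y}
    (hord : idealOrder I y = ((n : ℕ) : ℕ∞)) : IsSepKindPt g I n y := by
  obtain ⟨x, hxc, hyx, hordx⟩ := exists_isClosed_top_specializes g hY I hle hord
  refine ⟨by rwa [ringChar.eq k p], x, hyx, hxc, sepResidueAt_of_perfectField g hxc, hordx⟩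

/-- **kernel · over a PERFECT field at `p ∤ n` every top point is of class ≥ j, for every j.** KERNEL (PROVED). [folklore] -/
theorem classGE_of_perfectField {p : ℕ} (hp : p.Prime) {k : Type} [Field k] [CharP k p] [PerfectField k]
    {Y : Scheme.{0}} (g : Y ⟶ Spec (.of k)) (hB : IsBase Y g) (I : Y.IdealSheafData) {n : ℕ} (hn : 1 ≤ n)
    (hpn : ¬ p ∣ n) (hle : ∀ y : Y, idealOrder I y ≤ ((n : ℕ) : ℕ∞)) (j : ℕ) {y : Y}
    (hord : idealOrder I y = ((n : ℕ) : ℕ∞)) : ClassGE g hB.isRegular I n j y := by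
  haveI : QuasiCompact g := hB.quasiCompact
  haveI : LocallyOfFiniteType g := hB.locallyOfFiniteType
  exact classGE_of_isSepKindPt hp g hB I hn j hord (isSepKindPt_of_perfectField g hB.isRegular I hpn hle hord)

/-- **kernel · over a PERFECT field at `p ∤ n` NO top point is leaf-special** — the whole located class of the lineage
is EMPTY on the perfect-coprime slice; in particular g24's tame class (`p` odd, marking 2) never meets the residual over
a perfect field. KERNEL (PROVED). [folklore] -/
theorem not_isLeafSpecialPt_of_perfectField {p : ℕ} (hp : p.Prime) {k : Type} [Field k] [CharP k p] [PerfectField k]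
    {Y : Scheme.{0}} (g : Y ⟶ Spec (.of k)) (hB : IsBase Y g) (I : Y.IdealSheafData) {n : ℕ} (hn : 1 ≤ n)
    (hpn : ¬ p ∣ n) (hle : ∀ y : Y, idealOrder I y ≤ ((n : ℕ) : ℕ∞)) {y : Y}
    (hord : idealOrder I y = ((n : ℕ) : ℕ∞)) : ¬ IsLeafSpecialPt g hB.isRegular I n y :=
  fun hs => not_gen_of_isLeafSpecialPt hs (Or.inl (classGE_of_perfectField hp g hB I hn hpn hle 2 hord))

/-- **kernel · a CLOSED leaf-special point at `p ∤ n` has INSEPARABLE residue field, so the ground field is IMPERFECT.**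
KERNEL (PROVED). [folklore] -/
theorem not_sepResidueAt_of_isLeafSpecialPt {p : ℕ} (hp : p.Prime) {k : Type} [Field k] [CharP k p]
    {Y : Scheme.{0}} (g : Y ⟶ Spec (.of k)) (hB : IsBase Y g) (I : Y.IdealSheafData) {n : ℕ} (hn : 1 ≤ n)
    (hpn : ¬ p ∣ n) {y : Y} (hy : IsClosed ({y} : Set Y)) (hord : idealOrder I y = ((n : ℕ) : ℕ∞))
    (hs : IsLeafSpecialPt g hB.isRegular I n y) : ¬ SepResidueAt g y ∧ ¬ PerfectField k := by
  have hns : ¬ SepResidueAt g y := fun hsep =>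
    not_isLeafSpecialPt_of_isSepKindPt hp g hB I hn hord
      ⟨by rwa [ringChar.eq k p], y, specializes_rfl, hy, hsep, hord⟩ hs
  haveI : LocallyOfFiniteType g := hB.locallyOfFiniteType
  exact ⟨hns, not_perfectField_of_not_sepResidueAt g hy hns⟩

end Summit.ResolutionOfSingularities.ResolutionOfSingularities.Theorems.ResidueCut
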